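import Summits.ResolutionOfSingularities.ResolutionOfSingularities.Theorems.DeltaCutStellarTransform
import Literature.AlgebraicGeometry.Resolution.MonomialOrderReduction

/-!
# DeltaCutStellarStrategy — ADDENDUM tree file 5 of the decomp-res lens-6 g32 node «StellarCut»: THE TERMINATING FACE STRATEGY
# for the n.c. ideal shape `Hⁿ + Π K_j^{a_j}`, list level (core of g33 window (1)(c) `worNC_holds`)

Kollár's order reduction for marked MONOMIAL ideals ((3.111) Step 3; Literature `MonomialOrderReduction`,
`exists_isResolutionOf_monomialMarked`) blows up, in phases `r = 1, 2, …`, the `r`-fold intersections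
`E^{j_1} ∩ ⋯ ∩ E^{j_r}` of maximal weight `a_{j_1} + ⋯ + a_{j_r} ≥ m`, and terminates by the lexicographic
decrease of `(m_r, n_r)` under the side condition `(*_s)`, `s < r`.  THIS FILE RELATIVISES THAT STRATEGY TO THE
CONTACT HYPERSURFACE `H` of the n.c. ideal shape `𝓘 = Hⁿ + Π_j K_j^{a_j}` (boundary `E`, `H ∈ E`, `H :: E` s.n.c.):
only the sets of divisors CONTAINING `H` are measured (`StarBelowH`, `incSubsetsH`, `maxWeightH`, `numMaxH`), the
centres are the faces `H ∩ ⋂_{j ∈ S} K_j` of maximal weight `≥ n` through `H` in phase `r = |S| + 1`, and one round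
is the list-level round of `DeltaCutStellarTransform` (`ncShape_round`, `weakResolution_cons_face`: the transform is
`H'ⁿ + Π K_j'^{a_j}·F^{w-n}`, again of the shape, with `H' :: E'` s.n.c.).  The bookkeeping of one blow-up along a
stratum (`pre`, `weightOf_transformExp`, `image_pre_of_mem` / `image_pre_of_not_mem`, `card_pre_of_mem` /
`card_pre_of_not_mem`, `card_divThrough_transformExp_le`) is imported from Literature UNCHANGED; the three measure
lemmas are re-proved with the side condition `H ∈ T` threaded through (the one new remark: `H ∈ pre T'` whenever
`H' ∈ T'`, so the divisor `K₀ ∈ T ∖ pre T'` produced in Kollár's argument is never `H`):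

* `support_eq_empty_of_starBelowH` — at the end of phase `N` (`N` bounding the number of divisors through a point)
  the support `V(H) ∩ {Σ a_j ≥ n}` (label rule `mem_support_ncShape_iff_weightAt`) is empty;
* `starBelowH_transformExp` (`(*_s)^H`, `s < r`, persists), `weightOf_transformExp_leH`,
  `maxWeightH_transformExp_le`, `numMaxH_transformExp_lt` (**`(m_r^H, n_r^H)` decreases lexicographically**);
* `exists_weakResolution_of_starBelowH` (the induction) and
  ★ `exists_weakResolution_ncShape`: on a locally Noetherian `X`, every marked ideal `(Hⁿ + Π K_j^{a_j}, n)`, `n ≥ 1`,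
  with `H :: boundaryOf E` s.n.c. and `H ∈ boundaryOf E`, admits a tree `WeakResolution` (regular centres inside the
  successive supports, empty final support) — by FACE centres through the successive strict transforms of `H`.

What then remains for `worNC_holds` is only the bridge from the scheme-level letters (`IsNCStage`: an `NCFrame` with
`IsSNC`, `IdealShape`, `SuppLE` on an `IsBase` stage) to this list data.  0 sorry.  Imports: the pinned T4
`DeltaCutStellarTransform` + Literature `MonomialOrderReduction`.
-/

noncomputable section

open CategoryTheory CategoryTheory.Limits AlgebraicGeometry TopologicalSpace IsLocalRing
open Literature.AlgebraicGeometry.Resolution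

namespace Summit.ResolutionOfSingularities.ResolutionOfSingularities.Theorems.DeltaCutClasses

universe u

/-! ## The measure relative to `H`: only sets of divisors containing `H` count -/

section MeasureH

variable {X : Scheme.{u}}

/-- **`(*_s)^H` for all `s < r`**: every `s`-set of boundary divisors CONTAINING `H` with a common point, `s < r`,
has weight `< m`. -/
def StarBelowH (E : List (X.IdealSheafData × ℕ)) (H : X.IdealSheafData) (m r : ℕ) : Prop :=
  ∀ s < r, ∀ T ∈ incSubsets E s, H ∈ T → weightOf E T < m

/-- The `r`-sets of boundary divisors with a common point which contain `H`. -/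
def incSubsetsH (E : List (X.IdealSheafData × ℕ)) (H : X.IdealSheafData) (r : ℕ) :
    Finset (Finset X.IdealSheafData) := by
  classical exact (incSubsets E r).filter fun T => H ∈ T

/-- Membership in `incSubsetsH`. -/
theorem mem_incSubsetsH_iff {E : List (X.IdealSheafData × ℕ)} {H : X.IdealSheafData} {r : ℕ}
    {T : Finset X.IdealSheafData} : T ∈ incSubsetsH E H r ↔ T ∈ incSubsets E r ∧ H ∈ T := by
  classical
  simp only [incSubsetsH, Finset.mem_filter]

/-- **`m_r^H :=` the maximal weight of an `r`-set through `H` with a common point** (`0` if there is none). -/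
def maxWeightH (E : List (X.IdealSheafData × ℕ)) (H : X.IdealSheafData) (r : ℕ) : ℕ :=
  (incSubsetsH E H r).sup (weightOf E)

/-- **`n_r^H :=` the number of `r`-sets through `H` achieving `m_r^H`.** -/
def numMaxH (E : List (X.IdealSheafData × ℕ)) (H : X.IdealSheafData) (r : ℕ) : ℕ := by
  classical exact ((incSubsetsH E H r).filter fun T => weightOf E T = maxWeightH E H r).card

/-- The weight of a member of `incSubsetsH E H r` is at most `m_r^H`. -/
theorem weightOf_le_maxWeightH {E : List (X.IdealSheafData × ℕ)} {H : X.IdealSheafData} {r : ℕ}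
    {T : Finset X.IdealSheafData} (hT : T ∈ incSubsetsH E H r) : weightOf E T ≤ maxWeightH E H r :=
  Finset.le_sup (f := weightOf E) hT

/-- Passing to the next phase: if no `r`-set through `H` reaches `m`, `(*_r)^H` holds as well. -/
theorem StarBelowH.succ {E : List (X.IdealSheafData × ℕ)} {H : X.IdealSheafData} {m r : ℕ}
    (h : StarBelowH E H m r) (hr : ∀ T ∈ incSubsetsH E H r, weightOf E T < m) : StarBelowH E H m (r + 1) := by
  intro s hs T hT hHT
  rcases Nat.lt_succ_iff_lt_or_eq.mp hs with hs | rfl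
  · exact h s hs T hT hHT
  · exact hr T (mem_incSubsetsH_iff.mpr ⟨hT, hHT⟩)

/-- **"At the end of phase `N` we are done"**: if every point lies on at most `N` boundary divisors and `(*_s)^H`
holds for all `s ≤ N`, the support `V(H) ∩ {Σ a_j ≥ n}` of `(Hⁿ + Π K_j^{a_j}, n)` is empty. -/
theorem support_eq_empty_of_starBelowH {E : List (X.IdealSheafData × ℕ)} {H : X.IdealSheafData}
    (hEs : HasSNC (H :: boundaryOf E)) (hH : H ∈ boundaryOf E) {n : ℕ} (hn : 1 ≤ n) {N : ℕ}
    (hN : ∀ x, (divThrough E x).card ≤ N) (h : StarBelowH E H n (N + 1)) (M : MarkedIdeal X)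
    (hI : M.ideal = H ^ n + monomialIdeal E) (hμ : M.mult = n) : M.support = ∅ := by
  refine support_ncShape_eq_empty (hasSNC_boundaryOf_of_cons hEs) hn M hI hμ fun x hx => ?_
  rw [weightAt_eq_weightOf_divThrough]
  exact h (divThrough E x).card (Nat.lt_succ_of_le (hN x)) _ (divThrough_mem_incSubsets E x)
    (mem_divThrough_iff.mpr ⟨hH, hx⟩)

end MeasureH

/-! ## One blow-up along a face through `H`: the measure lemmas with `H ∈ T` threaded through -/

section StepH

variable {X X' : Scheme.{u}} [IsLocallyNoetherian X] {π : X' ⟶ X}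
  {E : List (X.IdealSheafData × ℕ)} {H : X.IdealSheafData} {T : Finset X.IdealSheafData} {n : ℕ}

omit [IsLocallyNoetherian X] in
/-- `H` is behind every set of new divisors containing its strict transform. -/
theorem mem_pre_of_strictTransform_mem (hH : H ∈ boundaryOf E) {T' : Finset X'.IdealSheafData}
    (hH' : strictTransformIdeal π (T.sup id) H ∈ T') : H ∈ pre E π T T' :=
  mem_pre_iff.mpr ⟨mem_sheaves_iff.mpr hH, hH'⟩

omit [IsLocallyNoetherian X] in
/-- The strict transform of `H` is a divisor of the transformed exponent list. -/
theorem strictTransform_mem_boundaryOf_transformExp (hH : H ∈ boundaryOf E) (m : ℕ) :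
    strictTransformIdeal π (T.sup id) H ∈ boundaryOf (transformExp E π T m) := by
  rw [boundaryOf_transformExp]
  exact List.mem_append_left _ (List.mem_map.mpr ⟨H, hH, rfl⟩)

variable (hE : HasSNC (boundaryOf E)) (hH : H ∈ boundaryOf E) (hT : ∀ K ∈ T, K ∈ boundaryOf E)
  (hHT : H ∈ T) (hπ : IsBlowup π (T.sup id))
include hE hH hT hHT hπ

/-- **`(*_s)^H` persists for `s < r`** when an `r`-set `T ∋ H` of weight `≥ n` is blown up (new `s`-sets through
`H'` and the exceptional divisor: `a_{i_1} + ⋯ + a_{i_{s-1}} + a_F < a_{i_1} + ⋯ + a_{i_{s-1}} + a_{K₀} < n` for a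
member `K₀` of `T` not behind them — never `H`, which is — as `a_F < a_{K₀}` by `(*_{r-1})^H` for `T ∖ {K₀} ∋ H`). -/
theorem starBelowH_transformExp {r : ℕ} (hTr : T ∈ incSubsets E r) (hmT : n ≤ weightOf E T)
    (hstar : StarBelowH E H n r) :
    StarBelowH (transformExp E π T n) (strictTransformIdeal π (T.sup id) H) n r := by
  classical
  intro s hs T' hT' hH'T'
  obtain ⟨hT'sub, hcard, ⟨x', hx'⟩⟩ := mem_incSubsets_iff.mp hT'
  obtain ⟨hTsub, hTcard, hTinc⟩ := mem_incSubsets_iff.mp hTr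
  have hHpre : H ∈ pre E π T T' := mem_pre_of_strictTransform_mem hH hH'T'
  rw [weightOf_transformExp]
  by_cases hF : (T.sup id).comap π ∈ T'
  · rw [if_pos hF]
    have hxC : π x' ∈ (T.sup id).support := by
      have h : x' ∈ (((T.sup id).comap π).support : Set X') := hx' _ hF
      rwa [Scheme.IdealSheafData.support_comap] at h
    have hxT : ∀ K ∈ T, π x' ∈ K.support := (mem_support_finsetSup_iff T _).mp hxC
    have hc := card_pre_of_mem hE hT hπ hT'sub hx' hF
    -- a member of `T` not behind `T'`; it is not `H`
    obtain ⟨K₀, hK₀T, hK₀p⟩ : ∃ K₀ ∈ T, K₀ ∉ pre E π T T' := by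
      by_contra h
      push Not at h
      have := Finset.card_le_card (show T ⊆ pre E π T T' from h)
      omega
    have hK₀H : K₀ ≠ H := fun h => hK₀p (h ▸ hHpre)
    -- `a_F < a_{K₀}` by `(*_{r-1})^H` for `T ∖ {K₀}`
    have hTK₀ : weightOf E T = expOf E K₀ + weightOf E (T.erase K₀) := by
      conv_lhs => rw [← Finset.insert_erase hK₀T]
      exact weightOf_insert E (Finset.notMem_erase K₀ T)
    have herase : weightOf E (T.erase K₀) < n := by
      refine hstar (r - 1) (by omega) _ (mem_incSubsets_iff.mpr ⟨?_, ?_, ?_⟩)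
        (Finset.mem_erase.mpr ⟨hK₀H.symm, hHT⟩)
      · exact (Finset.erase_subset _ _).trans hTsub
      · rw [Finset.card_erase_of_mem hK₀T, hTcard]
      · obtain ⟨y, hy⟩ := hTinc
        exact ⟨y, fun K hK => hy K (Finset.mem_of_mem_erase hK)⟩
    -- `(*_s)^H` for `pre T' ∪ {K₀}`
    have hQ : weightOf E (insert K₀ (pre E π T T')) < n := by
      refine hstar s hs _ (mem_incSubsets_iff.mpr ⟨?_, ?_, ⟨π x', ?_⟩⟩) (Finset.mem_insert_of_mem hHpre)
      · exact Finset.insert_subset (hTsub hK₀T) (pre_subset _)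
      · rw [Finset.card_insert_of_notMem hK₀p]; omega
      · intro K hK
        rcases Finset.mem_insert.mp hK with rfl | hK
        · exact hxT _ hK₀T
        · exact forall_mem_pre_mem_support hx' K hK
    rw [weightOf_insert E hK₀p] at hQ
    omega
  · rw [if_neg hF, add_zero]
    refine hstar s hs _ (mem_incSubsets_iff.mpr ⟨pre_subset _, ?_, ⟨π x', ?_⟩⟩) hHpre
    · rw [card_pre_of_not_mem hE hT hπ hT'sub hF hx', hcard]
    · exact forall_mem_pre_mem_support hx'

omit hHT in
/-- **After blowing up an `r`-set `T ∋ H` of maximal weight `m_r^H ≥ n`, every new `r`-set through `H'` has weight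
`≤ m_r^H`, and those of weight `m_r^H` are strict transforms of old maximal `r`-sets through `H` other than `T`.** -/
theorem weightOf_transformExp_leH {r : ℕ} (hTr : T ∈ incSubsets E r)
    (hTmax : weightOf E T = maxWeightH E H r) (hmT : n ≤ weightOf E T)
    (hstar : StarBelowH E H n r) {T' : Finset X'.IdealSheafData}
    (hT' : T' ∈ incSubsets (transformExp E π T n) r) (hH'T' : strictTransformIdeal π (T.sup id) H ∈ T') :
    weightOf (transformExp E π T n) T' ≤ maxWeightH E H r ∧
      (weightOf (transformExp E π T n) T' = maxWeightH E H r →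
        (T.sup id).comap π ∉ T' ∧ pre E π T T' ∈ incSubsets E r ∧
          weightOf E (pre E π T T') = maxWeightH E H r ∧ pre E π T T' ≠ T) := by
  classical
  obtain ⟨hT'sub, hcard, ⟨x', hx'⟩⟩ := mem_incSubsets_iff.mp hT'
  obtain ⟨hTsub, hTcard, hTinc⟩ := mem_incSubsets_iff.mp hTr
  have hHpre : H ∈ pre E π T T' := mem_pre_of_strictTransform_mem hH hH'T'
  rw [weightOf_transformExp]
  by_cases hF : (T.sup id).comap π ∈ T'
  · -- through the exceptional divisor: weight `< m_r^H`
    rw [if_pos hF]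
    have hc := card_pre_of_mem hE hT hπ hT'sub hx' hF
    have hpre : weightOf E (pre E π T T') < n := by
      refine hstar (r - 1) (by omega) _ (mem_incSubsets_iff.mpr ⟨pre_subset _, by omega, ⟨π x', ?_⟩⟩) hHpre
      exact forall_mem_pre_mem_support hx'
    refine ⟨by omega, fun h => ?_⟩
    omega
  · rw [if_neg hF, add_zero]
    have hpreInc : pre E π T T' ∈ incSubsets E r := mem_incSubsets_iff.mpr
      ⟨pre_subset _, by rw [card_pre_of_not_mem hE hT hπ hT'sub hF hx', hcard],
        ⟨π x', forall_mem_pre_mem_support hx'⟩⟩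
    refine ⟨weightOf_le_maxWeightH (mem_incSubsetsH_iff.mpr ⟨hpreInc, hHpre⟩),
      fun h => ⟨hF, hpreInc, h, fun hpT => ?_⟩⟩
    -- if `pre T' = T`, the strict transforms of the members of `T` would share the point `x'`
    have himg := image_pre_of_not_mem hT'sub hF
    rw [hpT] at himg
    have hxT : ∀ K ∈ T, x' ∈ (strictTransformIdeal π (T.sup id) K).support := fun K hK =>
      hx' _ (himg ▸ Finset.mem_image_of_mem _ hK)
    have hxC : π x' ∈ (T.sup id).support := (mem_support_finsetSup_iff T _).mpr fun K hK =>
      mem_support_of_mem_support_strictTransformIdeal (hxT K hK)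
    have hxF : x' ∈ ((T.sup id).comap π).support := by
      show x' ∈ (((T.sup id).comap π).support : Set X')
      rw [Scheme.IdealSheafData.support_comap]
      exact hxC
    obtain ⟨K₀, hK₀, hK₀'⟩ := exists_not_mem_support_strictTransformIdeal hE hT hπ hxF
    exact hK₀' (hxT K₀ hK₀)

omit hHT in
/-- **`m_r^H` does not increase.** -/
theorem maxWeightH_transformExp_le {r : ℕ} (hTr : T ∈ incSubsets E r)
    (hTmax : weightOf E T = maxWeightH E H r) (hmT : n ≤ weightOf E T)
    (hstar : StarBelowH E H n r) :
    maxWeightH (transformExp E π T n) (strictTransformIdeal π (T.sup id) H) r ≤ maxWeightH E H r :=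
  Finset.sup_le fun _ hT' =>
    (weightOf_transformExp_leH hE hH hT hπ hTr hTmax hmT hstar (mem_incSubsetsH_iff.mp hT').1
      (mem_incSubsetsH_iff.mp hT').2).1

/-- **`(m_r^H, n_r^H)` decreases lexicographically**: if `m_r^H` stays the same, `n_r^H` drops (the new maximal
`r`-sets through `H'` inject, by `pre`, into the old maximal `r`-sets through `H` other than `T`). -/
theorem numMaxH_transformExp_lt {r : ℕ} (hTr : T ∈ incSubsets E r)
    (hTmax : weightOf E T = maxWeightH E H r) (hmT : n ≤ weightOf E T)
    (hstar : StarBelowH E H n r)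
    (heq : maxWeightH (transformExp E π T n) (strictTransformIdeal π (T.sup id) H) r = maxWeightH E H r) :
    numMaxH (transformExp E π T n) (strictTransformIdeal π (T.sup id) H) r < numMaxH E H r := by
  classical
  unfold numMaxH
  rw [heq]
  set S' := (incSubsetsH (transformExp E π T n) (strictTransformIdeal π (T.sup id) H) r).filter
    fun T' => weightOf (transformExp E π T n) T' = maxWeightH E H r with hS'
  set S := (incSubsetsH E H r).filter fun T₁ => weightOf E T₁ = maxWeightH E H r with hS
  have hTS : T ∈ S := Finset.mem_filter.mpr ⟨mem_incSubsetsH_iff.mpr ⟨hTr, hHT⟩, hTmax⟩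
  -- `pre` maps `S'` injectively into `S ∖ {T}`
  have hmaps : ∀ T' ∈ S', pre E π T T' ∈ S.erase T := by
    intro T' hT'
    obtain ⟨hT'inc, hw⟩ := Finset.mem_filter.mp hT'
    obtain ⟨hT'inc, hH'T'⟩ := mem_incSubsetsH_iff.mp hT'inc
    obtain ⟨-, hpreInc, hpw, hne⟩ :=
      (weightOf_transformExp_leH hE hH hT hπ hTr hTmax hmT hstar hT'inc hH'T').2 hw
    exact Finset.mem_erase.mpr ⟨hne, Finset.mem_filter.mpr
      ⟨mem_incSubsetsH_iff.mpr ⟨hpreInc, mem_pre_of_strictTransform_mem hH hH'T'⟩, hpw⟩⟩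
  have hinj : Set.InjOn (pre E π T) (S' : Set (Finset X'.IdealSheafData)) := by
    intro T₁ h₁ T₂ h₂ hpre
    obtain ⟨h₁inc, hw₁⟩ := Finset.mem_filter.mp (Finset.mem_coe.mp h₁)
    obtain ⟨h₂inc, hw₂⟩ := Finset.mem_filter.mp (Finset.mem_coe.mp h₂)
    obtain ⟨h₁inc, hH₁⟩ := mem_incSubsetsH_iff.mp h₁inc
    obtain ⟨h₂inc, hH₂⟩ := mem_incSubsetsH_iff.mp h₂inc
    have hF₁ := ((weightOf_transformExp_leH hE hH hT hπ hTr hTmax hmT hstar h₁inc hH₁).2 hw₁).1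
    have hF₂ := ((weightOf_transformExp_leH hE hH hT hπ hTr hTmax hmT hstar h₂inc hH₂).2 hw₂).1
    rw [← image_pre_of_not_mem (mem_incSubsets_iff.mp h₁inc).1 hF₁,
      ← image_pre_of_not_mem (mem_incSubsets_iff.mp h₂inc).1 hF₂, hpre]
  calc S'.card ≤ (S.erase T).card := Finset.card_le_card_of_injOn _ hmaps hinj
    _ < S.card := Finset.card_erase_lt_of_mem hTS

end StepH

/-! ## The induction: a weak resolution of the n.c. ideal shape by faces through `H` -/

section InductionH

open Summit.ResolutionOfSingularities.ResolutionOfSingularities.Theorems.WeakOrderReduction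

/-- **The face strategy, phase by phase** (`P(r)`: every `(Hⁿ + Π K_j^{a_j}, n)` with `H :: E` s.n.c., at most `N`
divisors through any point, and `(*_s)^H` for all `s < r`, has a weak resolution): downward induction on
`r ≤ N + 1` (at `r = N + 1` the support is empty), and within phase `r` a lexicographic induction on
`(m_r^H, n_r^H)`, the step being the blow-up of the face of an `r`-set `T ∋ H` of maximal weight `≥ n`
(`ncShape_round`, `weakResolution_cons_face`). -/
theorem exists_weakResolution_of_starBelowH (N : ℕ) {n : ℕ} (hn : 1 ≤ n) :
    ∀ (d r : ℕ), r + d = N + 1 → ∀ (W c : ℕ) (X : Scheme.{0}) [IsLocallyNoetherian X]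
      (E : List (X.IdealSheafData × ℕ)) (H : X.IdealSheafData), HasSNC (H :: boundaryOf E) →
      H ∈ boundaryOf E → (∀ x, (divThrough E x).card ≤ N) → StarBelowH E H n r →
      maxWeightH E H r = W → numMaxH E H r = c → ∀ M : MarkedIdeal X,
      M.ideal = H ^ n + monomialIdeal E → M.mult = n → ∃ s : CentreSeq X, WeakResolution s M := by
  classical
  intro d
  induction d with
  | zero =>
    intro r hr W c X _ E H hEs hH hN hstar _ _ M hI hμ
    refine ⟨CentreSeq.nil X, weakResolution_nil_of_support_eq_empty M ?_⟩
    rw [Nat.add_zero] at hr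
    exact support_eq_empty_of_starBelowH hEs hH hn hN (hr ▸ hstar) M hI hμ
  | succ d ihd =>
    -- lexicographic induction on `(W, c) = (m_r^H, n_r^H)`
    intro r hr W
    induction W using Nat.strong_induction_on with
    | _ W ihW =>
    intro c
    induction c using Nat.strong_induction_on with
    | _ c ihc =>
    intro X _ E H hEs hH hN hstar hW hc M hI hμ
    by_cases hnext : ∀ T ∈ incSubsetsH E H r, weightOf E T < n
    · -- no `r`-set through `H` reaches `n`: `(*_r)^H` holds, pass to phase `r + 1`
      exact ihd (r + 1) (by omega) _ _ X E H hEs hH hN (hstar.succ hnext) rfl rfl M hI hμ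
    · -- blow up the face of an `r`-set through `H` of maximal weight
      push Not at hnext
      obtain ⟨T₀, hT₀, hmT₀⟩ := hnext
      obtain ⟨T, hTrH, hTmax⟩ := Finset.exists_mem_eq_sup (incSubsetsH E H r) ⟨T₀, hT₀⟩ (weightOf E)
      have hTmax' : weightOf E T = maxWeightH E H r := hTmax.symm
      have hmT : n ≤ weightOf E T := hmT₀.trans (hTmax ▸ weightOf_le_maxWeightH hT₀)
      obtain ⟨hTr, hHT⟩ := mem_incSubsetsH_iff.mp hTrH
      have hE : HasSNC (boundaryOf E) := hasSNC_boundaryOf_of_cons hEs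
      have hT : ∀ K ∈ T, K ∈ boundaryOf E := fun K hK =>
        mem_sheaves_iff.mp ((mem_incSubsets_iff.mp hTr).1 hK)
      have hT' : ∀ K ∈ T, K ∈ H :: boundaryOf E := fun K hK => List.mem_cons_of_mem _ (hT K hK)
      set C : X.IdealSheafData := T.sup id with hC
      haveI : IsLocallyNoetherian (blowup C) := CentreSeq.isLocallyNoetherian_blowup C
      have hπ : IsBlowup (blowup.π C) (T.sup id) := blowup.isBlowup C
      set E' := transformExp E (blowup.π C) T n with hE'
      set H' := strictTransformIdeal (blowup.π C) (T.sup id) H with hH'def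
      -- the transformed data
      obtain ⟨hI', hμ', hEs'⟩ := ncShape_round hEs hT' hHT hmT M hI hμ
      have hH' : H' ∈ boundaryOf E' := strictTransform_mem_boundaryOf_transformExp hH n
      have hN' : ∀ x', (divThrough E' x').card ≤ N := fun x' =>
        (card_divThrough_transformExp_le hE hT hπ x').trans (hN _)
      have hstar' : StarBelowH E' H' n r := starBelowH_transformExp hE hH hT hHT hπ hTr hmT hstar
      have hle : maxWeightH E' H' r ≤ W :=
        hW ▸ maxWeightH_transformExp_le hE hH hT hπ hTr hTmax' hmT hstar
      -- the induction hypothesis applies to the transform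
      obtain ⟨s', hs'⟩ : ∃ s' : CentreSeq (blowup C),
          WeakResolution s' (M.transform (blowup.π C) C) := by
        rcases hle.lt_or_eq with hlt | heq
        · exact ihW _ hlt _ (blowup C) E' H' hEs' hH' hN' hstar' rfl rfl _ hI' hμ'
        · have hlt : numMaxH E' H' r < c :=
            hc ▸ numMaxH_transformExp_lt hE hH hT hHT hπ hTr hTmax' hmT hstar (heq.trans hW.symm)
          exact ihc _ hlt (blowup C) E' H' hEs' hH' hN' hstar' heq rfl _ hI' hμ'
      -- prepend the blow-up of the face `C`
      exact ⟨CentreSeq.cons C s', weakResolution_cons_face hEs hT' hHT hn hmT M hI hμ hs'⟩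

/-- ★ **Weak order reduction for the n.c. ideal shape by the terminating face strategy**: on a locally Noetherian
scheme, a marked ideal `(Hⁿ + Π_j K_j^{a_j}, n)`, `n ≥ 1`, whose boundary `E = (K_j, a_j)_j` contains `H` and has
simple normal crossings together with `H`, admits a `WeakResolution`: finitely many blow-ups along regular centres
(the faces `H ∩ ⋂_{j ∈ S} K_j` of maximal weight `≥ n` in Kollár's phases, relativised to `H`) contained in the
successive supports, after which the support is empty. -/
theorem exists_weakResolution_ncShape {X : Scheme.{0}} [IsLocallyNoetherian X] {E : List (X.IdealSheafData × ℕ)}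
    {H : X.IdealSheafData} (hEs : HasSNC (H :: boundaryOf E)) (hH : H ∈ boundaryOf E) {n : ℕ} (hn : 1 ≤ n)
    (M : MarkedIdeal X) (hI : M.ideal = H ^ n + monomialIdeal E) (hμ : M.mult = n) :
    ∃ s : CentreSeq X, WeakResolution s M := by
  classical
  -- every point lies on at most `|sheaves E|` divisors
  set N := (sheaves E).card with hN
  have hbound : ∀ x, (divThrough E x).card ≤ N := fun x =>
    Finset.card_le_card fun K hK => mem_sheaves_iff.mpr (mem_divThrough_iff.mp hK).1
  exact exists_weakResolution_of_starBelowH N hn (N + 1) 0 (by omega) _ _ X E H hEs hH hbound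
    (fun s hs => absurd hs (Nat.not_lt_zero s)) rfl rfl M hI hμ

end InductionH

end Summit.ResolutionOfSingularities.ResolutionOfSingularities.Theorems.DeltaCutClasses
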